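import Summits.HodgeConjecture.HodgeConjecture.Theses.MumfordCurveRigidFibreCount

/-!
# Route `MumfordCurveRigidFibreCount` — assembly item `Assembly` (stmt-HodgeConjecture-20125)

The assembly item records, as a statement, the implication decided by the route's deciding theorem
`Theses.MumfordCurveRigidFibreCount.closes` (planner-authored, sorry-free, elaborating in the route file):
`InfiniteAnchorSaturation → MumfordSectorComplement → HodgeConjecture`.  The hypotheses of `closes` are
exactly these two cruxes in this order, so the item is closed by the deciding theorem itself.  Nothing here
is a case of the Hodge conjecture: both cruxes remain hypotheses.  No definition, no named-fact hypothesis,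
no sorry.
-/

set_option linter.dupNamespace false

noncomputable section

namespace Summit.HodgeConjecture.HodgeConjecture.Theorems

open Summit.HodgeConjecture.HodgeConjecture.Theses.MumfordCurveRigidFibreCount in
/-- **Item stmt-HodgeConjecture-20125 (`Assembly`, route `MumfordCurveRigidFibreCount`)**:
`InfiniteAnchorSaturation → MumfordSectorComplement → HodgeConjecture`, by the route's sorry-free deciding
theorem `closes` (the sector complement reduces the summit to the Mumford curve sector, where infinitely
many algebraic anchor fibres saturate every fibre of the family, Hodge models being supplied by
`nonempty_hodgeModel_holds`).  The type is literally the route decl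
`Summit.HodgeConjecture.HodgeConjecture.Theses.MumfordCurveRigidFibreCount.Assembly`.
[cite: CharlesSchnell2014Notes, Prop. 11.3.11] -/
theorem mumfordCurveRigidFibreCount_assembly_proof :
    Summit.HodgeConjecture.HodgeConjecture.Theses.MumfordCurveRigidFibreCount.Assembly := by
  unfold Summit.HodgeConjecture.HodgeConjecture.Theses.MumfordCurveRigidFibreCount.Assembly
  exact fun hX hR ↦ closes hX hR

end Summit.HodgeConjecture.HodgeConjecture.Theorems

end
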